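import Summits.BirchSwinnertonDyer.BirchSwinnertonDyer.Theorems.ManinLocalTwoThreeManinPrimeToAdditiveFiveLeReducibleResidueSharp
import Summits.BirchSwinnertonDyer.BirchSwinnertonDyer.Theorems.ManinLocalTwoThreeManinPrimeToAdditiveFiveLeReducibleResidueThirteenStub
import HarnessLib

/-!
# Route `ManinLocalTwoThree`, residual crux C5 `ManinPrimeToAdditiveFiveLe`
# (stmt-BirchSwinnertonDyer-22969), line `upper_anchor`: **THE LINE LEDGER on the sharpened cores —
# C5 BY NAME ⟸ six printed facts {F″, ČNS 1.2, Cremona ≤ 5·10⁵, Edixhoven Thm. 3 ×2, Mazur's X₀(p) list}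
# ∧ one registered open crux {KP57} ∧ two explicit open cores {RED(57)♯, RED(13)♯}**

Allocation ζ4 of the lead bsd-line-ml23-c5-p1 (gen 2; HOME INBOX 2026-08-28T06:52:11Z / 07:21:45Z).
Composition of three landed helpers:
* the width seat's `maninPrimeToAdditiveFiveLe_of_kato57_print_of_kp57_of_sharpCores` (p612504):
  C5 ⟸ {F″, ČNS, Cremona, EdK, EdG} ∧ KP57 ∧ RED(57)♯ ∧ RED(11)♯;
* the lead's `coreRED11_of_mazurJ_of_coreRED13` (p612408): RED(11) ⟸ MazurJ ∧ RED(13) — Mazur 1978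
  Thm. 1 with the eleven `j`-invariants of the non-cuspidal rational points of `X₀(p)`,
  `p ∈ {11, 17, 19, 37, 43, 67, 163}` (cite-only fact
  `Literature.NumberTheory.EllipticCurves.mazur_j_mem_of_not_hasIrreducibleModPGaloisRep_of_eleven_le`,
  p611848), contradicts «additive ∧ (G)-ordinary ∧ `ord_p Δ_min ≤ 4`» at every `p > 7` other than `13`;
* the lead's Cremona cut on RED(13), `coreRED13_of_cremona_of_coreRED13sharp` (sequel
  `…ReducibleResidueThirteenStub`): RED(13) ⟸ Cremona ∧ RED(13)♯, the clause `500000 < N(W)` appended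
  LAST (same convention as `coreRED11_of_cremona_of_coreRED11sharp` of p612504).

RESULT: `reducibleTwistMinimal_of_print_mazurJ_of_sharpCores` — the registered stub 2
`stub_reducibleTwistMinimal` VERBATIM ⟸ EdK ∧ EdG ∧ ČNS ∧ Cremona ∧ MazurJ ∧ RED(57)♯ ∧ RED(13)♯ — and
`maninPrimeToAdditiveFiveLe_of_kato57_print_mazurJ_of_kp57_of_sharpCores` — **crux C5
`Summit.BirchSwinnertonDyer.BirchSwinnertonDyer.Theses.ManinLocalTwoThree.ManinPrimeToAdditiveFiveLe` BY NAME
⟸ F″ ∧ ČNS ∧ Cremona ∧ EdK ∧ EdG ∧ MazurJ ∧ KP57 ∧ RED(57)♯ ∧ RED(13)♯**, where, on globally twist-minimal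
classes with a conductor-level lattice-optimal datum `D`, `E[p]` reducible and `p² ∣ N(W) > 5·10⁵`:
* RED(57)♯: `p ∈ {5, 7}`, no `Iₙ*` fibre at `p` (Kodaira II/III/IV/IV*/III*/II*), `p ∣ deg φ` ⟹ `p ∤ c(D)`;
* RED(13)♯: `p = 13`, `ord_13 Δ_min ≤ 4` (Kodaira II/III/IV), the (G)-ordinary `∃`-clause, `13 ∣ deg φ`
  ⟹ `13 ∤ c(D)` (the `X₀(13)` family; in Cremona's range it is met only below `5·10⁵`, hence empty by clause).

HONEST STATUS: conditional-result (`--supports … --as helper`); closes nothing. The six facts are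
statement-only cite-only tree facts (F″ a DERIVED READING of Kato 2004 + Kim–Nakamura 2020 +
Kosters–Pannekoek 2017 with a referee flag; ČNS 2024 Thm. 1.2; Cremona's table `|c| = 1` for
`N ≤ 5·10⁵`; Edixhoven 1991 Thm. 3 in two halves; Mazur 1978 Thm. 1 + `X₀(p)(ℚ)` `j`-list), KP57 is the
registered open crux stmt-BirchSwinnertonDyer-23810 of route `EdixhovenFibreFiveSeven`, and the two
sharpened cores are OPEN mathematics beyond the tables with no lever in the tree or in print. Nothing here
proves BSD, Manin's conjecture or C5. Seat bsd-line-ml23-c5-p1-w2 (width prover, gen 2).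

References: [Kato2004Asterisque] (8.1.3), Thm. 9.7; [KimNakamura2020] Cor. 2.4; [KostersPannekoek2017]
Thm. 1; [EdixhovenManin1991] Thm. 3; [CesnaviciusNeururerSaha2023] Thm. 1.2, §1 p. 2;
[Cremona2022ManinConstants]; [Mazur1978] Thm. 1; [LozanoRobledo2013MathAnn] Table 4; [Chiloyan2024]
Lemmas 8.6, 8.7.
-/

set_option autoImplicit false
-- the Theorems namespace of this sub repeats the summit name by design (D-0017 nested layout)
set_option linter.dupNamespace false

noncomputable section

open scoped Classical NumberField

namespace Summit.BirchSwinnertonDyer.BirchSwinnertonDyer.Theorems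

open WeierstrassCurve IsDedekindDomain NumberField
  Literature.NumberTheory.EllipticCurves Literature.NumberTheory.EllipticCurves.ModularForms
  Literature.NumberTheory.EllipticCurves.Rank1Residual
  Summit.BirchSwinnertonDyer.Rank1Residual.ManinAdditive
  Summit.BirchSwinnertonDyer.Rank1Residual.Additive
  Summit.BirchSwinnertonDyer.BirchSwinnertonDyer.Theses.EdixhovenFibreFiveSeven

/-! ## Stub 2 and C5 on the sharpened cores -/

/-- **STUB 2 `stub_reducibleTwistMinimal` of line `upper_anchor` (registered signature VERBATIM as the
conclusion) ⟸ Edixhoven Thm. 3 ×2 (`hEdK`, `hEdG`) ∧ ČNS Thm. 1.2 (`hCNS`) ∧ Cremona ≤ 5·10⁵ (`h500k`) ∧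
Mazur's `X₀(p)` list (`hJ`) ∧ the two SHARPENED open cores RED(57)♯ (`h57s`) and RED(13)♯ (`h13s`).**
Proof: the width seat's gen-1 `reducibleTwistMinimal_of_edixhoven_cns_of_cores` (p608852) fed with
`coreRED57_of_cns_cremona_of_coreRED57sharp` (p612504) and the lead's `coreRED11_of_mazurJ_of_coreRED13`
(p612408) ∘ the lead's `coreRED13_of_cremona_of_coreRED13sharp`. Conditional-result; the registered stub stays `sorry` in the skeleton.
[cite: EdixhovenManin1991, Thm. 3] [cite: CesnaviciusNeururerSaha2023, Thm. 1.2 and §1 p. 2]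
[cite: Mazur1978, Thm. 1] -/
theorem reducibleTwistMinimal_of_print_mazurJ_of_sharpCores
    (hEdK : edixhoven_not_dvd_maninConstant_of_kodairaSymbol_ne)
    (hEdG : edixhoven_not_dvd_maninConstant_of_not_potentiallyGoodOrdinary)
    (hCNS : cesnaviciusNeururerSaha_padicVal_maninConstant_le_modularDegree)
    (h500k : cremona_abs_maninConstant_eq_one_of_level_le_500000)
    (hJ : mazur_j_mem_of_not_hasIrreducibleModPGaloisRep_of_eleven_le)
    (h57s : mazur_not_dvd_maninConstant_of_odd → abbesUllmo_not_dvd_maninConstant_of_not_dvd_level →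
      cesnavicius_not_two_dvd_maninConstant_of_two_dvd_level → exists_isNewformOf →
      ∀ (W : WeierstrassCurve ℚ) [W.IsElliptic] [W.IsGloballyMinimal] [NeZero (W.conductorNorm ℤ)]
        (D : ModularParametrizationData W (W.conductorNorm ℤ)),
        IsLatticeOptimal D → ∀ (p : ℕ) (hp : p.Prime), (p = 5 ∨ p = 7) → p ^ 2 ∣ W.conductorNorm ℤ →
        ¬ (∃ (W' : WeierstrassCurve ℚ) (q : ℕ), W'.IsElliptic ∧ W'.IsGloballyMinimal ∧ q.Prime ∧
            q ≠ 2 ∧ q ^ 2 ∣ W.conductorNorm ℤ ∧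
            IsIsogenous W (W'.quadraticTwist (((-1 : ℤ) ^ (q / 2) * q : ℤ) : ℚ)) ∧
            ¬ q ^ 2 ∣ W'.conductorNorm ℤ) →
        ¬ (∃ (W' : WeierstrassCurve ℚ) (d : ℤ), W'.IsElliptic ∧ W'.IsGloballyMinimal ∧
            (d = -1 ∨ d = 2 ∨ d = -2) ∧ 2 ^ 2 ∣ W.conductorNorm ℤ ∧
            IsIsogenous W (W'.quadraticTwist (d : ℚ)) ∧ ¬ 2 ^ 2 ∣ W'.conductorNorm ℤ) →
        ¬ W.HasIrreducibleModPGaloisRep p →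
        500000 < W.conductorNorm ℤ →
        p ∣ D.modularDegree →
        (∀ n : ℕ, W.kodairaSymbolAt ((Rat.HeightOneSpectrum.primesEquiv (R := ℤ)).symm ⟨p, hp⟩) ≠
          .Istar n) →
        ¬ (p : ℤ) ∣ D.maninConstant)
    (h13s : mazur_not_dvd_maninConstant_of_odd → abbesUllmo_not_dvd_maninConstant_of_not_dvd_level →
      cesnavicius_not_two_dvd_maninConstant_of_two_dvd_level → exists_isNewformOf →
      ∀ (W : WeierstrassCurve ℚ) [W.IsElliptic] [W.IsGloballyMinimal] [NeZero (W.conductorNorm ℤ)]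
        (D : ModularParametrizationData W (W.conductorNorm ℤ)),
        IsLatticeOptimal D → ∀ p : ℕ, p.Prime → p = 13 → p ^ 2 ∣ W.conductorNorm ℤ →
        ¬ (∃ (W' : WeierstrassCurve ℚ) (q : ℕ), W'.IsElliptic ∧ W'.IsGloballyMinimal ∧ q.Prime ∧
            q ≠ 2 ∧ q ^ 2 ∣ W.conductorNorm ℤ ∧
            IsIsogenous W (W'.quadraticTwist (((-1 : ℤ) ^ (q / 2) * q : ℤ) : ℚ)) ∧
            ¬ q ^ 2 ∣ W'.conductorNorm ℤ) →
        ¬ (∃ (W' : WeierstrassCurve ℚ) (d : ℤ), W'.IsElliptic ∧ W'.IsGloballyMinimal ∧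
            (d = -1 ∨ d = 2 ∨ d = -2) ∧ 2 ^ 2 ∣ W.conductorNorm ℤ ∧
            IsIsogenous W (W'.quadraticTwist (d : ℚ)) ∧ ¬ 2 ^ 2 ∣ W'.conductorNorm ℤ) →
        ¬ W.HasIrreducibleModPGaloisRep p →
        padicValInt p W.minimalDiscriminantInt ≤ 4 →
        (∃ (L : Type) (_ : Field L) (_ : NumberField L) (_ : IsCyclotomicExtension {p} ℚ L)
            (F : IntermediateField ℚ L),
            ∀ w : HeightOneSpectrum (𝓞 F), (p : 𝓞 F) ∈ w.asIdeal →
              (W.baseChange F).HasGoodReductionAt w ∧ (W.baseChange F).HasUnitRootAt w) →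
        p ∣ D.modularDegree →
        500000 < W.conductorNorm ℤ →
        ¬ (p : ℤ) ∣ D.maninConstant) :
    mazur_not_dvd_maninConstant_of_odd → abbesUllmo_not_dvd_maninConstant_of_not_dvd_level →
    cesnavicius_not_two_dvd_maninConstant_of_two_dvd_level → exists_isNewformOf →
    ∀ (W : WeierstrassCurve ℚ) [W.IsElliptic] [W.IsGloballyMinimal] [NeZero (W.conductorNorm ℤ)]
      (D : ModularParametrizationData W (W.conductorNorm ℤ)),
      IsLatticeOptimal D → ∀ p : ℕ, p.Prime → 5 ≤ p → p ^ 2 ∣ W.conductorNorm ℤ →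
      ¬ (∃ (W' : WeierstrassCurve ℚ) (q : ℕ), W'.IsElliptic ∧ W'.IsGloballyMinimal ∧ q.Prime ∧
          q ≠ 2 ∧ q ^ 2 ∣ W.conductorNorm ℤ ∧
          IsIsogenous W (W'.quadraticTwist (((-1 : ℤ) ^ (q / 2) * q : ℤ) : ℚ)) ∧
          ¬ q ^ 2 ∣ W'.conductorNorm ℤ) →
      ¬ (∃ (W' : WeierstrassCurve ℚ) (d : ℤ), W'.IsElliptic ∧ W'.IsGloballyMinimal ∧
          (d = -1 ∨ d = 2 ∨ d = -2) ∧ 2 ^ 2 ∣ W.conductorNorm ℤ ∧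
          IsIsogenous W (W'.quadraticTwist (d : ℚ)) ∧ ¬ 2 ^ 2 ∣ W'.conductorNorm ℤ) →
      ¬ W.HasIrreducibleModPGaloisRep p →
      ¬ (p : ℤ) ∣ D.maninConstant :=
  reducibleTwistMinimal_of_edixhoven_cns_of_cores hEdK hEdG hCNS
    (coreRED57_of_cns_cremona_of_coreRED57sharp hCNS h500k h57s)
    (coreRED11_of_mazurJ_of_coreRED13 hJ (coreRED13_of_cremona_of_coreRED13sharp h500k h13s))

/-- **C5 `ManinPrimeToAdditiveFiveLe` BY NAME ⟸ six printed facts + KP57 + two SHARPENED open cores**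
(THE LINE LEDGER of `upper_anchor` after gen 2; conditional-result, C5 is NOT proved): Kato F″ (`hK57`),
ČNS Thm. 1.2 (`hCNS`), Cremona ≤ 5·10⁵ (`h500k`), Edixhoven Thm. 3 Kodaira half (`hEdK`) and ordinarity
half (`hEdG`), Mazur 1978 Thm. 1 + `X₀(p)(ℚ)` `j`-list (`hJ`); the registered crux KP57 BY NAME
(`hKP57`); cores RED(57)♯ (`h57s`) and RED(13)♯ (`h13s`). Proof: p612504 with its RED(11)♯ input
produced from `hJ`, `h500k`, `h13s` by the lead's p612408 and `coreRED13_of_cremona_of_coreRED13sharp`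
(RED(11) trivially implies RED(11)♯).
[cite: Kato2004Asterisque, (8.1.3) (p. 180), Thm. 9.7 (p. 189)] [cite: KimNakamura2020, Cor. 2.4]
[cite: KostersPannekoek2017, Thm. 1 and Cor. 2] [cite: EdixhovenManin1991, Thm. 3]
[cite: CesnaviciusNeururerSaha2023, Thm. 1.2 and §1 p. 2] [cite: Mazur1978, Thm. 1] -/
theorem maninPrimeToAdditiveFiveLe_of_kato57_print_mazurJ_of_kp57_of_sharpCores
    (hK57 : kato_neron_isIntegral_twistedSymbolSum_of_additive_five_le)
    (hCNS : cesnaviciusNeururerSaha_padicVal_maninConstant_le_modularDegree)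
    (h500k : cremona_abs_maninConstant_eq_one_of_level_le_500000)
    (hEdK : edixhoven_not_dvd_maninConstant_of_kodairaSymbol_ne)
    (hEdG : edixhoven_not_dvd_maninConstant_of_not_potentiallyGoodOrdinary)
    (hJ : mazur_j_mem_of_not_hasIrreducibleModPGaloisRep_of_eleven_le)
    (hKP57 : KPResidueManinUnitFiveSeven)
    (h57s : mazur_not_dvd_maninConstant_of_odd → abbesUllmo_not_dvd_maninConstant_of_not_dvd_level →
      cesnavicius_not_two_dvd_maninConstant_of_two_dvd_level → exists_isNewformOf →
      ∀ (W : WeierstrassCurve ℚ) [W.IsElliptic] [W.IsGloballyMinimal] [NeZero (W.conductorNorm ℤ)]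
        (D : ModularParametrizationData W (W.conductorNorm ℤ)),
        IsLatticeOptimal D → ∀ (p : ℕ) (hp : p.Prime), (p = 5 ∨ p = 7) → p ^ 2 ∣ W.conductorNorm ℤ →
        ¬ (∃ (W' : WeierstrassCurve ℚ) (q : ℕ), W'.IsElliptic ∧ W'.IsGloballyMinimal ∧ q.Prime ∧
            q ≠ 2 ∧ q ^ 2 ∣ W.conductorNorm ℤ ∧
            IsIsogenous W (W'.quadraticTwist (((-1 : ℤ) ^ (q / 2) * q : ℤ) : ℚ)) ∧
            ¬ q ^ 2 ∣ W'.conductorNorm ℤ) →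
        ¬ (∃ (W' : WeierstrassCurve ℚ) (d : ℤ), W'.IsElliptic ∧ W'.IsGloballyMinimal ∧
            (d = -1 ∨ d = 2 ∨ d = -2) ∧ 2 ^ 2 ∣ W.conductorNorm ℤ ∧
            IsIsogenous W (W'.quadraticTwist (d : ℚ)) ∧ ¬ 2 ^ 2 ∣ W'.conductorNorm ℤ) →
        ¬ W.HasIrreducibleModPGaloisRep p →
        500000 < W.conductorNorm ℤ →
        p ∣ D.modularDegree →
        (∀ n : ℕ, W.kodairaSymbolAt ((Rat.HeightOneSpectrum.primesEquiv (R := ℤ)).symm ⟨p, hp⟩) ≠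
          .Istar n) →
        ¬ (p : ℤ) ∣ D.maninConstant)
    (h13s : mazur_not_dvd_maninConstant_of_odd → abbesUllmo_not_dvd_maninConstant_of_not_dvd_level →
      cesnavicius_not_two_dvd_maninConstant_of_two_dvd_level → exists_isNewformOf →
      ∀ (W : WeierstrassCurve ℚ) [W.IsElliptic] [W.IsGloballyMinimal] [NeZero (W.conductorNorm ℤ)]
        (D : ModularParametrizationData W (W.conductorNorm ℤ)),
        IsLatticeOptimal D → ∀ p : ℕ, p.Prime → p = 13 → p ^ 2 ∣ W.conductorNorm ℤ →
        ¬ (∃ (W' : WeierstrassCurve ℚ) (q : ℕ), W'.IsElliptic ∧ W'.IsGloballyMinimal ∧ q.Prime ∧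
            q ≠ 2 ∧ q ^ 2 ∣ W.conductorNorm ℤ ∧
            IsIsogenous W (W'.quadraticTwist (((-1 : ℤ) ^ (q / 2) * q : ℤ) : ℚ)) ∧
            ¬ q ^ 2 ∣ W'.conductorNorm ℤ) →
        ¬ (∃ (W' : WeierstrassCurve ℚ) (d : ℤ), W'.IsElliptic ∧ W'.IsGloballyMinimal ∧
            (d = -1 ∨ d = 2 ∨ d = -2) ∧ 2 ^ 2 ∣ W.conductorNorm ℤ ∧
            IsIsogenous W (W'.quadraticTwist (d : ℚ)) ∧ ¬ 2 ^ 2 ∣ W'.conductorNorm ℤ) →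
        ¬ W.HasIrreducibleModPGaloisRep p →
        padicValInt p W.minimalDiscriminantInt ≤ 4 →
        (∃ (L : Type) (_ : Field L) (_ : NumberField L) (_ : IsCyclotomicExtension {p} ℚ L)
            (F : IntermediateField ℚ L),
            ∀ w : HeightOneSpectrum (𝓞 F), (p : 𝓞 F) ∈ w.asIdeal →
              (W.baseChange F).HasGoodReductionAt w ∧ (W.baseChange F).HasUnitRootAt w) →
        p ∣ D.modularDegree →
        500000 < W.conductorNorm ℤ →
        ¬ (p : ℤ) ∣ D.maninConstant) :
    Summit.BirchSwinnertonDyer.BirchSwinnertonDyer.Theses.ManinLocalTwoThree.ManinPrimeToAdditiveFiveLe := by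
  refine maninPrimeToAdditiveFiveLe_of_kato57_print_of_kp57_of_sharpCores hK57 hCNS h500k hEdK hEdG hKP57
    h57s ?_
  -- RED(11)♯ ⟸ RED(11) ⟸ MazurJ ∧ RED(13) ⟸ MazurJ ∧ Cremona ∧ RED(13)♯
  intro hM hAU hC hnf W _ _ _ D hD p hp h7 hpN hodd hdy hred hlow hGo hdeg _hN
  exact coreRED11_of_mazurJ_of_coreRED13 hJ (coreRED13_of_cremona_of_coreRED13sharp h500k h13s) hM hAU hC
    hnf W D hD p hp h7 hpN hodd hdy hred hlow hGo hdeg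

end Summit.BirchSwinnertonDyer.BirchSwinnertonDyer.Theorems

end
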